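import Mathlib.FieldTheory.IsAlgClosed.Basic
import Mathlib.LinearAlgebra.FiniteDimensional.Lemmas
import Literature.AnabelianGeometry.AbsoluteAnabelian.AbsTopIII.LinearSystems
import Literature.NumberTheory.DiophantineGeometry.FunctionFieldDivisorsResidueMap
import Literature.NumberTheory.DiophantineGeometry.FunctionFieldGenusProofs
import Literature.NumberTheory.DiophantineGeometry.FunctionFieldGenusInfinitePlacesProofs
import Literature.NumberTheory.DiophantineGeometry.FunctionFieldGenusRiemannTheoremProofs
import HarnessLib

/-!
# [AbsTopIII] Prop. 1.1 (ii) and Prop. 1.2 (i): linear systems on a curve — proofs (`LinearSystemsProp11Proofs`)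

Mochizuki, *Topics in Absolute Anabelian Geometry III*, §1, Proposition 1.1 (ii) "Review of
Linear Systems" and Proposition 1.2 (i) "Additive Structure via Linear Systems", p. 29–30 of the
author's manuscript (lit key `paper:url-5493eb38cbb7`; the journal pagination is not held).  This
is the second PROOF-ONLY companion of `AbsTopIII/LinearSystems.lean` (statements by
abc-iut-L4-t1, p403944; sibling `LinearSystemsProp12Proofs` = Prop. 1.2 (ii)(iii); the two
companions import only the statement module, so that they build independently — hence the two
`private` copies below of "every place is rational over `k = k̄`"); it DISCHARGES the named facts

* `Prop_1_1_ii` — `ℓ(D)` is the least `d ≥ 0` such that some effective divisor `E` of degree `d`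
  has `Γ^×(D - E) = ∅`; in particular `ℓ(D) = 0 ↔ Γ^×(D) = ∅`
  ("a consequence of the well-known theory of divisors on algebraic curves", p. 29);
* `Prop_1_2_i` — existence of distinct points `x, y₁, y₂ ∉ Supp(D)` and a divisor `D` with
  `ℓ(D) = 2` and `ℓ(D - e₁ - e₂) = 0` for every pair `{e₁, e₂} ⊆ {x, y₁, y₂}` (proof p. 30),

for the function field `K/k` of a proper curve over an algebraically closed field `k`.

## Proof (the printed argument of p. 30, made explicit)

The one tool is the *generic point*: for `0 ≠ f ∈ L(D)` every place `P` outside the finite set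
`Supp(D) ∪ Supp((f))` (Stichtenoth Cor. 1.3.4, `finite_setOf_ord_ne_zero_holds`) satisfies
`f ∉ L(D - P)`; since there are infinitely many places (Stichtenoth Cor. 1.3.2,
`infinite_placeOver_holds`) such `P` exist outside any finite set (`exists_generic_place`), and
then `ℓ(D - P) = ℓ(D) - 1` because every place has degree one over `k = k̄`
(Stichtenoth Lemma 1.4.8, `ell_add_single_le`; `ell_sub_pointDivisor_add_one`).  Prop. 1.1 (ii):
subtract `ℓ(D)` generic points one at a time (`exists_effective_ell_sub_eq_zero`); conversely
`ℓ(D) ≤ ℓ(D - E) + deg E` (Lemma 1.4.8, `ell_add_le_of_nonneg`).  Prop. 1.2 (i), as printed: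
"Let `D` be any divisor on `X` such that `l(D) ≥ 2`" — `D₀ = (g + 1)·P₀` by Riemann's inequality
(`degree_add_one_sub_ell_le_genus_holds`) — "By subtracting an appropriate effective divisor from
`D`, we may assume that `l(D) = 2`" (`exists_ell_eq_two`). "Then take `x ∈ X(k) \ Supp(D)` to be
any point such that `𝒪_X(D)` admits a global section that does not vanish at `x` [so
`l(D - x) = 1`]; take `y₁` [...] such that `𝒪_X(D - x)` admits a global section that does not
vanish at `y₁` [so `l(D - x - y₁) = 0`, which implies that `l(D - y₁) = 1`]; take `y₂` [...] such
that `𝒪_X(D - x)`, `𝒪_X(D - y₁)` admit global sections that do not vanish at `y₂` [so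
`l(D - x - y₂) = l(D - y₁ - y₂) = 0`]."  The hypothesis `2 ≤ g` of the named facts is not used.

No new definitions; nothing here takes a side on [IUTchIII] Cor. 3.12.
-/

noncomputable section

open scoped Classical

namespace Literature.AnabelianGeometry.AbsoluteAnabelian.AbsTopIII

open Literature.NumberTheory.DiophantineGeometry
open Literature.NumberTheory.DiophantineGeometry.AlgFunctionField

universe u v

variable {k : Type u} {K : Type v} [Field k] [Field K] [Algebra k K]

/-! ### Every place is rational over an algebraically closed constant field -/

/-- For `k` algebraically closed, `k → k(v)` is bijective (`k(v)/k` is finite, Stichtenoth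
Prop. 1.1.15). Private copy of `algebraMap_residueField_bijective_of_isAlgClosed`
(`LinearSystemsProp12Proofs`) so that this file imports only the statement module.
[cite: Stichtenoth2009, Prop. 1.1.15] -/
private theorem algebraMap_residueField_bijective' [IsAlgClosed k] [IsAlgFunctionField k K]
    (v : PlaceOver k K) : Function.Bijective (algebraMap k v.residueField) := by
  haveI : FiniteDimensional k v.residueField :=
    PlaceOver.finiteDimensional_residueField_holds (K := k) (F := K) v
  haveI : Algebra.IsIntegral k v.residueField := Algebra.IsIntegral.of_finite k _
  exact IsAlgClosed.algebraMap_bijective_of_isIntegral (k := k) (K := v.residueField)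

/-- For `k` algebraically closed every place of `K/k` has degree one. Private copy of
`placeDegree_eq_one_of_isAlgClosed` (`LinearSystemsProp12Proofs`).
[cite: Stichtenoth2009, Def. 1.1.14 and Prop. 1.1.15] -/
private theorem degree_eq_one' [IsAlgClosed k] [IsAlgFunctionField k K] (v : PlaceOver k K) :
    v.degree = 1 := by
  have e := (LinearEquiv.ofBijective (Algebra.linearMap k v.residueField)
    (algebraMap_residueField_bijective' (k := k) (K := K) v)).finrank_eq
  rw [Module.finrank_self] at e
  exact e.symm

/-! ### `Γ^×(D) = ∅` versus `ℓ(D) = 0` -/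

/-- `Γ^×(D) = ∅ ↔ L(D) = 0` (`Γ^×(D)` is `L(D) ∖ {0}` seen in `K^×`).
[cite: MochizukiAbsTopIII2015, Prop 1.1 (i) p.29] -/
private theorem gammaTimes_eq_empty_iff (D : Divisor k K) :
    gammaTimes D = ∅ ↔ riemannRochSpace D = ⊥ := by
  constructor
  · intro h
    by_contra hne
    obtain ⟨f, hf, hf0⟩ := Submodule.exists_mem_ne_zero_of_ne_bot hne
    have : Units.mk0 f hf0 ∈ gammaTimes D := by
      rw [mem_gammaTimes_iff]
      simpa using hf
    rw [h] at this
    exact this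
  · intro h
    ext f
    simp only [Set.mem_empty_iff_false, iff_false, mem_gammaTimes_iff, h, Submodule.mem_bot]
    exact f.ne_zero

/-- In a function field of one variable `ℓ(D) = 0 ↔ L(D) = 0` (`L(D)` is finite-dimensional,
Stichtenoth Prop. 1.4.9). [cite: Stichtenoth2009, Prop. 1.4.9] -/
private theorem ell_eq_zero_iff [IsAlgFunctionField k K] (D : Divisor k K) :
    ell D = 0 ↔ riemannRochSpace D = ⊥ := by
  haveI : FiniteDimensional k (riemannRochSpace D) := finiteDimensional_riemannRochSpace_holds D
  exact Submodule.finrank_eq_zero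

/-- `0 < ℓ(D)` produces a nonzero element of `L(D)`. [cite: Stichtenoth2009, Def. 1.4.4] -/
private theorem exists_ne_zero_mem_of_ell_pos [IsAlgFunctionField k K] {D : Divisor k K}
    (h : 0 < ell D) : ∃ f : K, f ∈ riemannRochSpace D ∧ f ≠ 0 := by
  refine Submodule.exists_mem_ne_zero_of_ne_bot fun hbot ↦ ?_
  rw [← ell_eq_zero_iff] at hbot
  omega

/-! ### Generic points -/

/-- If `P ∉ Supp(D)` and `ord_P f = 0` (`f ≠ 0`), then `f ∉ L(D - P)`: a section that does not
vanish at `P` is not a section of `𝒪(D - P)`. [cite: Stichtenoth2009, Def. 1.4.4] -/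
private theorem not_mem_riemannRochSpace_sub_pointDivisor {D : Divisor k K} {P : PlaceOver k K} {f : K}
    (hf0 : f ≠ 0) (hP : D P = 0) (hord : P.ord f = 0) :
    f ∉ riemannRochSpace (D - pointDivisor P) := by
  intro h
  have h1 := h P
  have e : -((D - pointDivisor P) P) = 1 := by simp [pointDivisor, hP]
  rw [e, P.valuation_le_zpow_iff_le_ord hf0] at h1
  omega

/-- **Generic points.** Given nonzero `f₁, f₂ ∈ K`, divisors `D₁, D₂` and a finite set `S` of
places, there is a place `P ∉ S` outside `Supp(D₁) ∪ Supp(D₂)` at which neither `f₁` nor `f₂` has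
a zero or pole, so that `fᵢ ∉ L(Dᵢ - P)` ("take `y₂ ∈ X(k) \ (Supp(D) ∪ {x, y₁})` to be any
point such that `𝒪_X(D - x)`, `𝒪_X(D - y₁)` admit global sections that do not vanish at `y₂`",
p. 30; infinitely many places, Stichtenoth Cor. 1.3.2, finitely many zeros and poles, Cor. 1.3.4).
[cite: MochizukiAbsTopIII2015, Prop 1.2 (i) p.30] -/
private theorem exists_generic_place [IsAlgFunctionField k K] (S : Finset (PlaceOver k K))
    (D₁ D₂ : Divisor k K) {f₁ f₂ : K} (h₁ : f₁ ≠ 0) (h₂ : f₂ ≠ 0) :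
    ∃ P : PlaceOver k K, P ∉ S ∧ D₁ P = 0 ∧ D₂ P = 0 ∧
      f₁ ∉ riemannRochSpace (D₁ - pointDivisor P) ∧ f₂ ∉ riemannRochSpace (D₂ - pointDivisor P) := by
  haveI : Infinite (PlaceOver k K) := infinite_placeOver_holds
  have hfin₁ := finite_setOf_ord_ne_zero_holds (K := k) (F := K) h₁
  have hfin₂ := finite_setOf_ord_ne_zero_holds (K := k) (F := K) h₂
  obtain ⟨P, hP⟩ := Infinite.exists_notMem_finset
    (S ∪ D₁.support ∪ D₂.support ∪ hfin₁.toFinset ∪ hfin₂.toFinset)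
  simp only [Finset.mem_union, not_or, Finsupp.mem_support_iff, not_not, Set.Finite.mem_toFinset,
    Set.mem_setOf_eq] at hP
  obtain ⟨⟨⟨⟨hS, hD₁⟩, hD₂⟩, ho₁⟩, ho₂⟩ := hP
  exact ⟨P, hS, hD₁, hD₂, not_mem_riemannRochSpace_sub_pointDivisor h₁ hD₁ ho₁,
    not_mem_riemannRochSpace_sub_pointDivisor h₂ hD₂ ho₂⟩

/-- Over an algebraically closed constant field, removing a point at which some section of
`𝒪(D)` does not vanish drops `ℓ` by exactly one: `f ∈ L(D) ∖ L(D - P) ⇒ ℓ(D - P) + 1 = ℓ(D)`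
(Stichtenoth Lemma 1.4.8 with `deg P = 1`; "[so `l(D - x) = 1`]", p. 30).
[cite: MochizukiAbsTopIII2015, Prop 1.2 (i) p.30] -/
private theorem ell_sub_pointDivisor_add_one [IsAlgClosed k] [IsAlgFunctionField k K] {D : Divisor k K}
    {P : PlaceOver k K} {f : K} (hf : f ∈ riemannRochSpace D)
    (hnot : f ∉ riemannRochSpace (D - pointDivisor P)) : ell (D - pointDivisor P) + 1 = ell D := by
  haveI : FiniteDimensional k (riemannRochSpace D) := finiteDimensional_riemannRochSpace_holds D
  have hle : D - pointDivisor P ≤ D := sub_le_self D (Finsupp.single_nonneg.2 zero_le_one)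
  have hlt : riemannRochSpace (D - pointDivisor P) < riemannRochSpace D :=
    lt_of_le_of_ne (riemannRochSpace_mono hle) fun h ↦ hnot (h ▸ hf)
  have h1 := Submodule.finrank_lt_finrank_of_lt hlt
  have h2 := ell_add_single_le (K := k) (F := K) (D - pointDivisor P) P
  have e : D - pointDivisor P + Finsupp.single P 1 = D := by simp [pointDivisor]
  rw [e, degree_eq_one'] at h2
  change Module.finrank k _ < Module.finrank k _ at h1
  unfold ell at h2 ⊢
  omega

/-! ### Proposition 1.1 (ii) -/

/-- "By subtracting an appropriate effective divisor": there is an effective `E` of degree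
`ℓ(D)` with `ℓ(D - E) = 0` (induction on `ℓ(D)`, one generic point at a time).
[cite: MochizukiAbsTopIII2015, Prop 1.1 (ii) p.29] -/
private theorem exists_effective_ell_sub_eq_zero [IsAlgClosed k] [IsAlgFunctionField k K] :
    ∀ (n : ℕ) (D : Divisor k K), ell D = n →
      ∃ E : Divisor k K, 0 ≤ E ∧ E.degree = n ∧ ell (D - E) = 0 := by
  intro n
  induction n with
  | zero => exact fun D hD ↦ ⟨0, le_rfl, by simp, by simpa using hD⟩
  | succ n ih =>
    intro D hD
    obtain ⟨f, hf, hf0⟩ := exists_ne_zero_mem_of_ell_pos (D := D) (by omega)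
    obtain ⟨P, -, -, -, hnot, -⟩ := exists_generic_place ∅ D D hf0 hf0
    have hP := ell_sub_pointDivisor_add_one hf hnot
    obtain ⟨E, hE, hdeg, hℓ⟩ := ih (D - pointDivisor P) (by omega)
    refine ⟨E + pointDivisor P, add_nonneg hE (Finsupp.single_nonneg.2 zero_le_one), ?_, ?_⟩
    · rw [map_add, hdeg, Divisor.degree_single, degree_eq_one']
      push_cast
      ring
    · rwa [add_comm, ← sub_sub]

/-- **DISCHARGE of `Prop_1_1_ii`** ([AbsTopIII] Prop. 1.1 (ii), p. 29): "The integer `l(D) ≥ 0`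
is equal to the smallest nonnegative integer `d` such that there exists an effective divisor `E`
of degree `d` on `X` for which `Γ^×(D - E) = ∅`. In particular, `l(D) = 0` if and only if
`Γ^×(D) = ∅`." [cite: MochizukiAbsTopIII2015, Prop 1.1 (ii) p.29] -/
theorem Prop_1_1_ii_holds : Prop_1_1_ii.{u, v} := by
  intro k K _ _ _ _ _ _ D
  refine ⟨⟨?_, ?_⟩, ?_⟩
  · obtain ⟨E, hE, hdeg, hℓ⟩ := exists_effective_ell_sub_eq_zero (ell D) D rfl
    exact ⟨E, hE, hdeg, (gammaTimes_eq_empty_iff _).2 ((ell_eq_zero_iff _).1 hℓ)⟩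
  · rintro d ⟨E, hE, hdeg, hempty⟩
    have h0 : ell (D - E) = 0 := (ell_eq_zero_iff _).2 ((gammaTimes_eq_empty_iff _).1 hempty)
    have h := ell_add_le_of_nonneg (K := k) (F := K) (D - E) hE
    rw [sub_add_cancel, h0, hdeg, Nat.cast_zero, zero_add] at h
    exact_mod_cast h
  · rw [ell_eq_zero_iff, gammaTimes_eq_empty_iff]

/-! ### Proposition 1.2 (i) -/

/-- "By subtracting an appropriate effective divisor from `D`, we may assume that `l(D) = 2`":
from any `D` with `ℓ(D) = n + 2` one reaches a divisor with `ℓ = 2`.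
[cite: MochizukiAbsTopIII2015, Prop 1.2 (i) p.30] -/
private theorem exists_ell_eq_two [IsAlgClosed k] [IsAlgFunctionField k K] :
    ∀ (n : ℕ) (D : Divisor k K), ell D = n + 2 → ∃ D' : Divisor k K, ell D' = 2 := by
  intro n
  induction n with
  | zero => exact fun D hD ↦ ⟨D, hD⟩
  | succ n ih =>
    intro D hD
    obtain ⟨f, hf, hf0⟩ := exists_ne_zero_mem_of_ell_pos (D := D) (by omega)
    obtain ⟨P, -, -, -, hnot, -⟩ := exists_generic_place ∅ D D hf0 hf0
    have hP := ell_sub_pointDivisor_add_one hf hnot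
    exact ih (D - pointDivisor P) (by omega)

/-- "Let `D` be any divisor on `X` such that `l(D) ≥ 2`": `D₀ = (g + 1) P₀` has `ℓ(D₀) ≥ 2` by
Riemann's inequality `ℓ(D) ≥ deg D + 1 - g` (Stichtenoth Thm. 1.4.17 (a)); hence a divisor with
`ℓ = 2` exists. [cite: MochizukiAbsTopIII2015, Prop 1.2 (i) p.30] -/
private theorem exists_divisor_ell_eq_two [IsAlgClosed k] [IsAlgFunctionField k K] :
    ∃ D : Divisor k K, ell D = 2 := by
  obtain ⟨P₀⟩ := nonempty_placeOver (K := k) (F := K)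
  set D₀ : Divisor k K := Finsupp.single P₀ ((genus k K : ℤ) + 1) with hD₀
  have h := degree_add_one_sub_ell_le_genus_holds (K := k) (F := K) D₀
  rw [hD₀, Divisor.degree_single, degree_eq_one'] at h
  push_cast at h
  have h2 : 2 ≤ ell (Finsupp.single P₀ ((genus k K : ℤ) + 1)) := by omega
  obtain ⟨m, hm⟩ := Nat.exists_eq_add_of_le h2
  exact exists_ell_eq_two m (Finsupp.single P₀ ((genus k K : ℤ) + 1)) (by omega)

/-- **DISCHARGE of `Prop_1_2_i`** ([AbsTopIII] Prop. 1.2 (i), p. 29): "There exist distinct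
points `x, y₁, y₂ ∈ X(k)`, together with a divisor `D` on `X` such that `x, y₁, y₂ ∉ Supp(D)`,
such that `l(D) = 2`, `l(D - E) = 0`, for any effective divisor `E = e₁ + e₂`, where `e₁ ≠ e₂`,
`{e₁, e₂} ⊆ {x, y₁, y₂}`" — by the printed choice of generic points (p. 30).
[cite: MochizukiAbsTopIII2015, Prop 1.2 (i) p.29] -/
theorem Prop_1_2_i_holds : Prop_1_2_i.{u, v} := by
  intro k K _ _ _ _ _ _
  -- "we may assume that l(D) = 2"
  obtain ⟨D, hD⟩ := exists_divisor_ell_eq_two (k := k) (K := K)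
  -- "take x ∈ X(k) \ Supp(D) ... a global section that does not vanish at x [so l(D - x) = 1]"
  obtain ⟨f, hf, hf0⟩ := exists_ne_zero_mem_of_ell_pos (D := D) (by omega)
  obtain ⟨x, -, hDx, -, hfx, -⟩ := exists_generic_place ∅ D D hf0 hf0
  have hℓx : ell (D - pointDivisor x) = 1 := by
    have := ell_sub_pointDivisor_add_one hf hfx
    omega
  -- "take y₁ ∉ Supp(D) ∪ {x} ... O_X(D - x) ... does not vanish at y₁ [so l(D - x - y₁) = 0]"
  obtain ⟨g, hg, hg0⟩ := exists_ne_zero_mem_of_ell_pos (D := D - pointDivisor x) (by omega)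
  obtain ⟨y₁, hy₁S, hDy₁', -, hgy₁, -⟩ :=
    exists_generic_place {x} (D - pointDivisor x) (D - pointDivisor x) hg0 hg0
  have hxy₁ : x ≠ y₁ := fun h ↦ hy₁S (by simp [h])
  have hDy₁ : D y₁ = 0 := by simpa [pointDivisor, hxy₁] using hDy₁'
  have hℓxy₁ : ell (D - pointDivisor x - pointDivisor y₁) = 0 := by
    have := ell_sub_pointDivisor_add_one hg hgy₁
    omega
  -- "[which implies that l(D - y₁) = 1]"
  have hℓy₁ : ell (D - pointDivisor y₁) = 1 := by
    have h1 := ell_add_single_le (K := k) (F := K) (D - pointDivisor y₁) y₁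
    have e1 : D - pointDivisor y₁ + Finsupp.single y₁ 1 = D := by simp [pointDivisor]
    rw [e1, hD, degree_eq_one'] at h1
    have h2 := ell_add_single_le (K := k) (F := K) (D - pointDivisor y₁ - pointDivisor x) x
    have e2 : D - pointDivisor y₁ - pointDivisor x + Finsupp.single x 1 = D - pointDivisor y₁ := by
      simp [pointDivisor]
    rw [e2, sub_right_comm, hℓxy₁, degree_eq_one'] at h2
    omega
  -- "take y₂ ∉ Supp(D) ∪ {x, y₁} ... O_X(D - x), O_X(D - y₁) ... do not vanish at y₂"
  obtain ⟨h, hh, hh0⟩ := exists_ne_zero_mem_of_ell_pos (D := D - pointDivisor y₁) (by omega)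
  obtain ⟨y₂, hy₂S, hDy₂', -, hgy₂, hhy₂⟩ :=
    exists_generic_place {x, y₁} (D - pointDivisor x) (D - pointDivisor y₁) hg0 hh0
  have hxy₂ : x ≠ y₂ := fun e ↦ hy₂S (by simp [e])
  have hy₁y₂ : y₁ ≠ y₂ := fun e ↦ hy₂S (by simp [e])
  have hDy₂ : D y₂ = 0 := by simpa [pointDivisor, hxy₂] using hDy₂'
  -- "[so l(D - x - y₂) = l(D - y₁ - y₂) = 0]"
  have hℓxy₂ : ell (D - pointDivisor x - pointDivisor y₂) = 0 := by
    have := ell_sub_pointDivisor_add_one hg hgy₂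
    omega
  have hℓy₁y₂ : ell (D - pointDivisor y₁ - pointDivisor y₂) = 0 := by
    have := ell_sub_pointDivisor_add_one hh hhy₂
    omega
  exact ⟨D, x, y₁, y₂, ⟨hxy₁, hxy₂, hy₁y₂, hDx, hDy₁, hDy₂, hD, hℓxy₁, hℓxy₂, hℓy₁y₂⟩⟩

end Literature.AnabelianGeometry.AbsoluteAnabelian.AbsTopIII
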